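import Literature.NumberTheory.Weil1964.LocalLinearChangeOfVariables
import HarnessLib

/-!
# The module of `X ↦ g X` and `X ↦ X g` on `M_n(F)` over a non-archimedean local field is `‖det g‖_F ^ n`
# (Weil, *Basic Number Theory*, Chap. I §2, Th. 3 Cor. 3) — for EVERY additive Haar measure on `M_n(F)`

Topic `NumberTheory/Weil1964`; namespace `Literature.NumberTheory.Weil1964`.  KERNEL mathematics only (theorems; no definition,
no named fact, no instance, no notation, no `sorry`).  Cell `pub/hodgecm-mathlib`, F0∕P3a, seat F0P3a-p08 (g11); LEAD DESK WORD T6-52: part (I)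
of the brick «D-T1a» of the #88 repair census `F0/P3a/F0P3a-p05/g9/SIZING-S1prime.v2.F0P3a-p05g9.md` §5 (road D-T1 `GaugeFormMeasure`: the
Tamagawa ∕ `|ω|_v` road behind (K7-s) and print's `m(Z_H∖H)` constants [Rogawski1990 §1.7 p. 6 «`dg = |ω|`», Thm. 14.5.1 p. 234]).  Part (II)
`GLnHaarOfAddHaar` builds the Haar measure `‖det X‖_F^{-n} dX` of `GL_n(F)` on these module computations.

THE MATHEMATICS.  ★ `LocalLinearChangeOfVariables` proves Weil's `mod_{F^ι}(A) = ‖det A‖_F` in the form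
`(toLin' A)_* μ^⊗ι = ‖det A‖⁻¹ μ^⊗ι` for the PRODUCT measure `μ^⊗ι` on `ι → F`.  Here we pass to the matrix space `M_n(F) = Matrix n n F`
(topology of `n → n → F`; Mathlib has no `MeasurableSpace (Matrix …)` instance, so the Borel structure of `M_n(F)` is a HYPOTHESIS, as for
`GL_n(F)` in the Godement–Jacquet files) and to an ARBITRARY additive Haar measure `dX` on it (no measurable structure on `F` is assumed in the
heads: an auxiliary Haar measure on `F` is chosen inside the proofs):
* §1 (private `pi_const_smul`), **`pi_map_apply_toLin'_eq_smul`** — on `n → (n → F)` with the iterated product measure `(μ^⊗n)^⊗n`, the coordinatewise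
  map `f ↦ (i ↦ A f_i)` has module `‖det A‖ⁿ`: `(f ↦ A ∘ f)_* (μ^⊗n)^⊗n = (‖det A‖⁻¹)ⁿ (μ^⊗n)^⊗n` (Mathlib `Measure.pi_map_pi` + ★ pi module).
* §2 the two transports `n → n → F ≃ M_n(F)` by ROWS (`Matrix.of`) and by COLUMNS (`f ↦ (Matrix.of f)ᵀ`): continuity, the intertwining
  identities `(of f) * g = of (i ↦ gᵀ f_i)`, `g * (of f)ᵀ = (of (j ↦ g f_j))ᵀ`, and **`eq_smul_map_of_isAddHaarMeasure`**: every additive Haar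
  measure `dX` on `M_n(F)` is `c₀ •` the image of `(μ^⊗n)^⊗n` under any bi-continuous additive bijection `(n → n → F) ≃+ M_n(F)`, `c₀ ∈ (0, ∞)`
  (Haar uniqueness, Mathlib `isAddLeftInvariant_eq_smul`; `M_n(F)` is second countable and locally compact); `map_eq_smul_of_semiconj` transports
  a module computation from `(μ^⊗n)^⊗n` to `dX`.
* §3 HEADS **`map_mul_right_eq_smul`**: `(X ↦ X g)_* dX = (‖det g‖_F⁻¹)ⁿ • dX` and **`map_mul_left_eq_smul`**: `(X ↦ g X)_* dX = (‖det g‖_F⁻¹)ⁿ • dX`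
  for every `g ∈ M_n(F)` with `det g ≠ 0` and EVERY additive Haar measure `dX` on `M_n(F)` — «`mod_{M_n}(X ↦ gX) = mod_F(det g)ⁿ`», the
  non-archimedean twin of Mathlib's `Real.map_matrix_volume_pi_eq_smul_volume_pi` ∕ `map_linearMap_addHaar_eq_smul_addHaar`; and the
  `lintegral` substitution forms `lintegral_comp_mul_right`, `lintegral_comp_mul_left`.
HONEST LABEL: HC_CM is proved only modulo the printed citations until rung 0 closes; count-neutral generic brick (no stub closes).

## References
* [WeilBNT1967] A. Weil, *Basic Number Theory*, Grundlehren 144 (1967), Chap. I §2, p. 3 (module of an automorphism), Th. 3 Cor. 3 pp. 6–7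
  (`mod_V(A) = mod_K(det A)`); Chap. I §4 (`M_n` over a `p`-field).
* [Rogawski1990] J. D. Rogawski, *Automorphic Representations of Unitary Groups in Three Variables*, Ann. of Math. Stud. 123 (1990), §1.7 p. 6.
* [Tate1950] J. Tate, *Fourier analysis in number fields and Hecke's zeta-functions*, §2.2 Lemma 2.2.5 (`d(aξ) = |a| dξ`).
-/

set_option autoImplicit false

noncomputable section

open MeasureTheory MeasureTheory.Measure ValuativeRel Filter Topology Set Matrix
open scoped NNReal ENNReal
open Literature.NumberTheory.GaloisRepresentations.IsNonarchimedeanLocalField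
open Literature.NumberTheory.Automorphic

namespace Literature.NumberTheory.Weil1964

variable {F : Type*} [Field F] [ValuativeRel F] [TopologicalSpace F] [IsNonarchimedeanLocalField F]
variable {n : Type*} [Fintype n]

/-! ## §1 The coordinatewise map `f ↦ (i ↦ A f_i)` on `n → (n → F)` has module `‖det A‖ⁿ` -/

section Pi

/-- product of a constant multiple: `⊗_{i ∈ n} (c • ν) = c ^ n • ⊗_i ν` for a `σ`-finite `ν` and `c ∈ ℝ≥0`. [folklore] -/
private theorem pi_const_smul {α : Type*} [MeasurableSpace α] (ν : Measure α) [SigmaFinite ν] (c : ℝ≥0) :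
    Measure.pi (fun _ : n => (c : ℝ≥0∞) • ν) = (c : ℝ≥0∞) ^ Fintype.card n • Measure.pi fun _ : n => ν := by
  haveI : SigmaFinite ((c : ℝ≥0∞) • ν) := by rw [Measure.coe_nnreal_smul]; infer_instance
  refine Measure.pi_eq fun s _ => ?_
  rw [Measure.smul_apply, smul_eq_mul, Measure.pi_pi]
  simp only [Measure.smul_apply, smul_eq_mul]
  rw [Finset.prod_mul_distrib, Finset.prod_const, Finset.card_univ]

variable [MeasurableSpace F] [BorelSpace F] (μ : Measure F) [μ.IsAddHaarMeasure]

omit [BorelSpace F] in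
/-- a Haar measure on `F` is `σ`-finite (instance helper: `F` is `σ`-compact and second countable). [folklore] -/
private theorem sigmaFinite_haar' : SigmaFinite μ := by
  haveI : T2Space F := (Literature.NumberTheory.GaloisRepresentations.IsNonarchimedeanLocalField.isLocalField F).toT2Space
  haveI : LocallyCompactSpace F :=
    (Literature.NumberTheory.GaloisRepresentations.IsNonarchimedeanLocalField.isLocalField F).toLocallyCompactSpace
  haveI : SecondCountableTopology F := secondCountableTopology_localField F
  infer_instance

/-- **module of the coordinatewise linear map**: for `A ∈ M_n(F)` with `det A ≠ 0`,
`(f ↦ (i ↦ A f_i))_* (μ^⊗n)^⊗n = (‖det A‖_F⁻¹)ⁿ • (μ^⊗n)^⊗n` on `n → (n → F)` (★ `map_toLin'_pi_eq_smul` in each coordinate, Fubini through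
Mathlib `Measure.pi_map_pi`). [cite: WeilBNT1967, Chap. I §2, Th. 3 Cor. 3, pp. 6–7] -/
theorem pi_map_apply_toLin'_eq_smul [DecidableEq n] {A : Matrix n n F} (hA : A.det ≠ 0) :
    Measure.map (fun f : n → n → F => fun i => Matrix.toLin' A (f i)) (Measure.pi fun _ : n => Measure.pi fun _ : n => μ) =
      (((normAbs F A.det⁻¹ : ℝ≥0) : ℝ≥0∞) ^ Fintype.card n) • Measure.pi fun _ : n => Measure.pi fun _ : n => μ := by
  haveI := sigmaFinite_haar' μ
  have hone : Measure.map (Matrix.toLin' A) (Measure.pi fun _ : n => μ) =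
      ((normAbs F A.det⁻¹ : ℝ≥0) : ℝ≥0∞) • Measure.pi fun _ : n => μ := map_toLin'_pi_eq_smul μ hA
  have hsf : ∀ _i : n, SigmaFinite (Measure.map (Matrix.toLin' A) (Measure.pi fun _ : n => μ)) := fun _ => by
    rw [hone, Measure.coe_nnreal_smul]; infer_instance
  rw [Measure.pi_map_pi (hμ := hsf) fun _ => (measurable_toLin' A).aemeasurable]
  simp_rw [hone]
  exact pi_const_smul (Measure.pi fun _ : n => μ) _

end Pi

/-! ## §2 Rows and columns: `n → n → F ≃ M_n(F)`; additive Haar measures on `M_n(F)` -/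

section Algebra

omit [Field F] [ValuativeRel F] [IsNonarchimedeanLocalField F] [Fintype n] in
/-- `Matrix.of : (n → n → F) → M_n(F)` is continuous (the topologies coincide). [folklore] -/
private theorem continuous_matrix_of : Continuous (Matrix.of : (n → n → F) → Matrix n n F) :=
  continuous_pi fun i => continuous_pi fun j => (continuous_apply j).comp (continuous_apply i)

omit [Field F] [ValuativeRel F] [IsNonarchimedeanLocalField F] [Fintype n] in
/-- `Matrix.of.symm : M_n(F) → (n → n → F)` is continuous. [folklore] -/
private theorem continuous_matrix_of_symm : Continuous (Matrix.of.symm : Matrix n n F → n → n → F) :=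
  continuous_pi fun i => continuous_pi fun j => by
    show Continuous fun X : Matrix n n F => X i j
    exact continuous_id.matrix_elem i j

omit [ValuativeRel F] [TopologicalSpace F] [IsNonarchimedeanLocalField F] in
/-- **rows**: `(of f) * g = of (i ↦ gᵀ f_i)` — right multiplication acts on each row by `v ↦ v g = gᵀ v` (Weil's reduction of the module of
`M_n` to the module of `F^n`). [cite: WeilBNT1967, Chap. I §2, Th. 3 Cor. 3, pp. 6–7] -/
theorem of_mul_eq_of_toLin'_transpose [DecidableEq n] (f : n → n → F) (g : Matrix n n F) :
    Matrix.of f * g = Matrix.of fun i => Matrix.toLin' gᵀ (f i) := by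
  ext i j
  simp only [Matrix.mul_apply, Matrix.of_apply, Matrix.toLin'_apply, Matrix.mulVec, dotProduct, Matrix.transpose_apply]
  exact Finset.sum_congr rfl fun k _ => mul_comm _ _

omit [ValuativeRel F] [TopologicalSpace F] [IsNonarchimedeanLocalField F] in
/-- **columns**: `g * (of f)ᵀ = (of (j ↦ g f_j))ᵀ` — left multiplication acts on each column by `v ↦ g v` (Weil's reduction of the module of
`M_n` to the module of `F^n`). [cite: WeilBNT1967, Chap. I §2, Th. 3 Cor. 3, pp. 6–7] -/
theorem mul_transpose_of_eq [DecidableEq n] (f : n → n → F) (g : Matrix n n F) :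
    g * (Matrix.of f)ᵀ = (Matrix.of fun j => Matrix.toLin' g (f j))ᵀ := by
  ext i j
  simp only [Matrix.mul_apply, Matrix.transpose_apply, Matrix.of_apply, Matrix.toLin'_apply, Matrix.mulVec, dotProduct]

/-- `M_n(F)` is second countable (instance helper). [folklore] -/
private theorem secondCountable_matrix : SecondCountableTopology (Matrix n n F) := by
  haveI : SecondCountableTopology F := secondCountableTopology_localField F
  change SecondCountableTopology (n → n → F)
  infer_instance

/-- `M_n(F)` is locally compact (instance helper). [folklore] -/
private theorem locallyCompact_matrix : LocallyCompactSpace (Matrix n n F) := by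
  haveI : LocallyCompactSpace F :=
    (Literature.NumberTheory.GaloisRepresentations.IsNonarchimedeanLocalField.isLocalField F).toLocallyCompactSpace
  change LocallyCompactSpace (n → n → F)
  infer_instance

variable [MeasurableSpace F] [BorelSpace F]

/-- the product `σ`-algebra on `n → n → F` is its Borel `σ`-algebra (instance helper: `F` is second countable). [folklore] -/
private theorem borel_pi_pi : BorelSpace (n → n → F) := by
  haveI : SecondCountableTopology F := secondCountableTopology_localField F
  infer_instance

variable (μ : Measure F) [μ.IsAddHaarMeasure]

/-- the iterated product measure `(μ^⊗n)^⊗n` on `n → n → F` is an additive Haar measure (instance helper). [folklore] -/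
private theorem isAddHaarMeasure_pi_pi : (Measure.pi fun _ : n => Measure.pi fun _ : n => μ).IsAddHaarMeasure := by
  haveI := sigmaFinite_haar' μ
  haveI : SecondCountableTopology F := secondCountableTopology_localField F
  infer_instance

variable [MeasurableSpace (Matrix n n F)] [BorelSpace (Matrix n n F)]

/-- **Every additive Haar measure on `M_n(F)` is a positive multiple of the image of `(μ^⊗n)^⊗n` under a bi-continuous additive bijection
`e : (n → n → F) → M_n(F)`** (Haar uniqueness on the second countable locally compact group `M_n(F)`, Mathlib `isAddLeftInvariant_eq_smul`;
applied below to the row and the column transports). [cite: WeilBNT1967, Chap. I §2, Th. 1 and Cor., pp. 3–4] -/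
theorem eq_smul_map_of_isAddHaarMeasure (dX : Measure (Matrix n n F)) [dX.IsAddHaarMeasure]
    (e : (n → n → F) ≃+ Matrix n n F) (he : Continuous e) (he' : Continuous e.symm) :
    ∃ c : ℝ≥0, 0 < c ∧ dX = c • Measure.map e (Measure.pi fun _ : n => Measure.pi fun _ : n => μ) := by
  haveI := secondCountable_matrix (F := F) (n := n)
  haveI := locallyCompact_matrix (F := F) (n := n)
  haveI := borel_pi_pi (F := F) (n := n)
  haveI := isAddHaarMeasure_pi_pi μ (n := n)
  haveI : (Measure.map e (Measure.pi fun _ : n => Measure.pi fun _ : n => μ)).IsAddHaarMeasure :=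
    AddEquiv.isAddHaarMeasure_map _ e he he'
  exact ⟨dX.addHaarScalarFactor (Measure.map e (Measure.pi fun _ : n => Measure.pi fun _ : n => μ)),
    addHaarScalarFactor_pos_of_isAddHaarMeasure _ _, isAddLeftInvariant_eq_smul _ _⟩

/-- **transport of a module computation**: if `Φ ∘ e = e ∘ Ψ` for a bi-continuous additive bijection `e : (n → n → F) → M_n(F)`, measurable
`Φ`, `Ψ`, and `Ψ_* (μ^⊗n)^⊗n = c • (μ^⊗n)^⊗n`, then `Φ_* dX = c • dX` for every additive Haar measure `dX` on `M_n(F)`.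
[cite: WeilBNT1967, Chap. I §2, pp. 3–4] -/
theorem map_eq_smul_of_semiconj (dX : Measure (Matrix n n F)) [dX.IsAddHaarMeasure]
    (e : (n → n → F) ≃+ Matrix n n F) (he : Continuous e) (he' : Continuous e.symm)
    {Φ : Matrix n n F → Matrix n n F} (hΦ : Measurable Φ) {Ψ : (n → n → F) → (n → n → F)} (hΨ : Measurable Ψ)
    (hconj : ∀ f, Φ (e f) = e (Ψ f)) {c : ℝ≥0∞}
    (hmod : Measure.map Ψ (Measure.pi fun _ : n => Measure.pi fun _ : n => μ) = c • Measure.pi fun _ : n => Measure.pi fun _ : n => μ) :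
    Measure.map Φ dX = c • dX := by
  haveI := borel_pi_pi (F := F) (n := n)
  obtain ⟨c₀, -, hdX⟩ := eq_smul_map_of_isAddHaarMeasure μ dX e he he'
  have hem : Measurable e := he.measurable
  have hcomp : Φ ∘ e = e ∘ Ψ := funext hconj
  conv_lhs => rw [hdX]
  rw [Measure.map_smul, Measure.map_map hΦ hem, hcomp, ← Measure.map_map hem hΨ, hmod, Measure.map_smul, smul_comm, ← hdX]

end Algebra

/-! ## §3 HEADS: `(X ↦ X g)_* dX = (‖det g‖⁻¹)ⁿ dX` and `(X ↦ g X)_* dX = (‖det g‖⁻¹)ⁿ dX` for every additive Haar `dX` on `M_n(F)` -/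

section Module

variable [MeasurableSpace (Matrix n n F)] [BorelSpace (Matrix n n F)]

omit [ValuativeRel F] [IsNonarchimedeanLocalField F] in
/-- `X ↦ X g` is measurable on `M_n(F)`. [folklore] -/
private theorem measurable_mul_right [IsTopologicalRing F] (g : Matrix n n F) : Measurable fun X : Matrix n n F => X * g :=
  (continuous_id.matrix_mul continuous_const).measurable

omit [ValuativeRel F] [IsNonarchimedeanLocalField F] in
/-- `X ↦ g X` is measurable on `M_n(F)`. [folklore] -/
private theorem measurable_mul_left [IsTopologicalRing F] (g : Matrix n n F) : Measurable fun X : Matrix n n F => g * X :=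
  (continuous_const.matrix_mul continuous_id).measurable

variable (dX : Measure (Matrix n n F)) [dX.IsAddHaarMeasure] [DecidableEq n]

/-- **THE MODULE OF RIGHT MULTIPLICATION**: `(X ↦ X g)_* dX = (‖det g‖_F⁻¹)ⁿ • dX` for every `g ∈ M_n(F)` with `det g ≠ 0` and every additive
Haar measure `dX` on `M_n(F)` — i.e. `dX(S g⁻¹) = ‖det g‖⁻ⁿ dX(S)`, `mod_{M_n(F)}(X ↦ X g) = ‖det g‖_Fⁿ` (rows: `X g` has rows `gᵀ X_i`; an
auxiliary Haar measure on `F` is chosen inside the proof). [cite: WeilBNT1967, Chap. I §2, Th. 3 Cor. 3, pp. 6–7] -/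
theorem map_mul_right_eq_smul {g : Matrix n n F} (hg : g.det ≠ 0) :
    Measure.map (fun X : Matrix n n F => X * g) dX = (((normAbs F g.det⁻¹ : ℝ≥0) : ℝ≥0∞) ^ Fintype.card n) • dX := by
  letI : MeasurableSpace F := borel F
  haveI : BorelSpace F := ⟨rfl⟩
  haveI : LocallyCompactSpace F :=
    (Literature.NumberTheory.GaloisRepresentations.IsNonarchimedeanLocalField.isLocalField F).toLocallyCompactSpace
  haveI := borel_pi_pi (F := F) (n := n)
  have hgt : gᵀ.det ≠ 0 := by rwa [Matrix.det_transpose]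
  refine map_eq_smul_of_semiconj (Measure.addHaar : Measure F) dX Matrix.ofAddEquiv continuous_matrix_of continuous_matrix_of_symm
    (measurable_mul_right g) (Ψ := fun f : n → n → F => fun i => Matrix.toLin' gᵀ (f i)) ?_
    (fun f => of_mul_eq_of_toLin'_transpose f g) ?_
  · exact (continuous_pi fun i => (LinearMap.continuous_on_pi _).comp (continuous_apply i)).measurable
  · rw [pi_map_apply_toLin'_eq_smul _ hgt, Matrix.det_transpose]

/-- **THE MODULE OF LEFT MULTIPLICATION**: `(X ↦ g X)_* dX = (‖det g‖_F⁻¹)ⁿ • dX` for every `g ∈ M_n(F)` with `det g ≠ 0` and every additive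
Haar measure `dX` on `M_n(F)` (columns: `g X` has columns `g X^j`). [cite: WeilBNT1967, Chap. I §2, Th. 3 Cor. 3, pp. 6–7] -/
theorem map_mul_left_eq_smul {g : Matrix n n F} (hg : g.det ≠ 0) :
    Measure.map (fun X : Matrix n n F => g * X) dX = (((normAbs F g.det⁻¹ : ℝ≥0) : ℝ≥0∞) ^ Fintype.card n) • dX := by
  letI : MeasurableSpace F := borel F
  haveI : BorelSpace F := ⟨rfl⟩
  haveI : LocallyCompactSpace F :=
    (Literature.NumberTheory.GaloisRepresentations.IsNonarchimedeanLocalField.isLocalField F).toLocallyCompactSpace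
  haveI := borel_pi_pi (F := F) (n := n)
  refine map_eq_smul_of_semiconj (Measure.addHaar : Measure F) dX (Matrix.ofAddEquiv.trans (Matrix.transposeAddEquiv n n F)) ?_ ?_
    (measurable_mul_left g) (Ψ := fun f : n → n → F => fun j => Matrix.toLin' g (f j)) ?_ (fun f => mul_transpose_of_eq f g)
    (pi_map_apply_toLin'_eq_smul _ hg)
  · exact continuous_matrix_of.matrix_transpose
  · show Continuous fun X : Matrix n n F => Matrix.of.symm Xᵀ
    exact continuous_matrix_of_symm.comp continuous_id.matrix_transpose
  · exact (continuous_pi fun i => (LinearMap.continuous_on_pi _).comp (continuous_apply i)).measurable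

/-- **substitution rule, right**: `∫⁻ G(X g) dX = (‖det g‖⁻¹)ⁿ ∫⁻ G dX` for measurable `G ≥ 0`. [cite: WeilBNT1967, Chap. I §2, p. 3] -/
theorem lintegral_comp_mul_right {g : Matrix n n F} (hg : g.det ≠ 0) {G : Matrix n n F → ℝ≥0∞} (hG : Measurable G) :
    ∫⁻ X, G (X * g) ∂dX = (((normAbs F g.det⁻¹ : ℝ≥0) : ℝ≥0∞) ^ Fintype.card n) * ∫⁻ X, G X ∂dX := by
  rw [← lintegral_map hG (measurable_mul_right g), map_mul_right_eq_smul dX hg, lintegral_smul_measure, smul_eq_mul]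

/-- **substitution rule, left**: `∫⁻ G(g X) dX = (‖det g‖⁻¹)ⁿ ∫⁻ G dX` for measurable `G ≥ 0`. [cite: WeilBNT1967, Chap. I §2, p. 3] -/
theorem lintegral_comp_mul_left {g : Matrix n n F} (hg : g.det ≠ 0) {G : Matrix n n F → ℝ≥0∞} (hG : Measurable G) :
    ∫⁻ X, G (g * X) ∂dX = (((normAbs F g.det⁻¹ : ℝ≥0) : ℝ≥0∞) ^ Fintype.card n) * ∫⁻ X, G X ∂dX := by
  rw [← lintegral_map hG (measurable_mul_left g), map_mul_left_eq_smul dX hg, lintegral_smul_measure, smul_eq_mul]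

end Module

end Literature.NumberTheory.Weil1964

end
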